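import Mathlib
import Literature.NumberTheory.Sieve.ParityBarrier
import Summits.Parity.GeneralizedHardyLittlewood.Theorems.ParityLeakOneFifthPlainSplitRoughMass
import HarnessLib

/-!
# Route ParityLeakOneFifth, crux `PlainSplit` (item stmt-Parity-18382), line `birth`:
# bookkeeping for stub `stub_roughLiouville` — the rough model as a sifted shifted interval,
# and the remainder classes of the signed interval sieve

With the route's `z`-rough model `b_n = 1[P⁻(n) ≥ z]/V(z)` on the window `(x, 2x]`
(`z = exp((log log x)²)`, `V(z) = ∏_{p<z}(1 − 1/p)`), this file provides the dictionary used by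
`stub_roughLiouville` (file `ParityLeakOneFifthPlainSplitRoughLiouville.lean`):

* `rough_add_iff`, `sum_model_liouville_eq`: `V · Σ_{x<n≤2x} b_n λ(n+2)` is the sum of the weight
  `σ(r) = λ(x+r+2)·1[2 ∤ x+r]` over the `r ≤ x` avoiding the classes `r ≡ −x (mod p)`, `p < z`
  (for `z > 2` the sifted `n = x + r` are odd) — the shape of the tree's signed interval sieve
  `Literature.NumberTheory.Sieve.IntervalClassSieve.abs_signedSum_le`;
* `filter_admissible_subset`, `sum_admissible_le`: at a squarefree modulus `d` the admissible
  classes of that sieve reduce to the single class `r ≡ −x (mod d)`, i.e. `d ∣ x + r`;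
* `dvd_and_odd_iff`, `abs_classSum_le_of_odd`: for odd `d` the class sum of `σ` is
  `Σ_{x+2<m≤2x+2, m ≡ d+2 (mod 2d)} λ(m)`, a reduced class modulo `2d`, written as the difference of
  two Liouville sums of the shape consumed by the tree's Bombieri–Vinogradov theorem for `λ`
  (`Literature.NumberTheory.Sieve.BVLiouvilleHeights.bv_liouvilleAP`).

Everything here is elementary bookkeeping (no analytic input).
-/

namespace Summit.Parity.GeneralizedHardyLittlewood.Theorems.ParityLeakOneFifth

open Finset Real
open Literature.NumberTheory.Sieve

/-! ### Dictionary: the rough model on `(x, 2x]` as a sifted shifted interval -/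

/-- Pointwise form of `card_rough_Ioc_eq`: for `r ≥ 1`, `x + r` is `z`-rough iff
`r % p ≠ (p − x % p) % p` for every prime `p < z`. -/
theorem rough_add_iff (x : ℕ) (z : ℝ) {r : ℕ} (hr : 1 ≤ r) :
    (∀ p ∈ (x + r).primeFactors, z ≤ (p : ℝ)) ↔
      ∀ p ∈ Nat.primesBelow ⌈z⌉₊, r % p ∉ ({(p - x % p) % p} : Finset ℕ) := by
  simp only [Finset.mem_singleton]
  constructor
  · intro h p hp
    rw [Nat.mem_primesBelow] at hp
    rw [← dvd_add_iff_mod_eq hp.2.pos]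
    intro hdvd
    have hzp := h p (Nat.mem_primeFactors.2 ⟨hp.2, hdvd, by omega⟩)
    exact absurd (Nat.lt_ceil.1 hp.1) (not_lt.2 hzp)
  · intro h p hp
    obtain ⟨hpr, hdvd, -⟩ := Nat.mem_primeFactors.1 hp
    by_contra hlt
    rw [not_le] at hlt
    have h' := h p (Nat.mem_primesBelow.2 ⟨Nat.lt_ceil.2 hlt, hpr⟩)
    rw [← dvd_add_iff_mod_eq hpr.pos] at h'
    exact h' hdvd

/-- `V · Σ_{x<n≤2x} b_n λ(n+2)` is the sum of `σ(r) = λ(x+r+2)·1[2 ∤ x+r]` over the sifted `r ≤ x`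
(for `z > 2` the sifted `n = x + r` are odd). -/
theorem sum_model_liouville_eq (x : ℕ) {z : ℝ} (hz : 2 < z) (V : ℝ) :
    ∑ n ∈ Ioc x (2 * x), (if ∀ p ∈ n.primeFactors, z ≤ (p : ℝ) then 1 / V else 0) *
        (ArithmeticFunction.liouville (n + 2) : ℝ) =
      (1 / V) * ∑ r ∈ (Icc 1 x).filter (fun r : ℕ => ∀ p ∈ Nat.primesBelow ⌈z⌉₊,
          r % p ∉ ({(p - x % p) % p} : Finset ℕ)),
        (if 2 ∣ x + r then 0 else (ArithmeticFunction.liouville (x + r + 2) : ℝ)) := by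
  have hI : Ioc x (2 * x) = (Icc 1 x).map (addLeftEmbedding x) := by
    rw [← zero_add 1, Finset.Icc_add_one_left_eq_Ioc, Finset.map_add_left_Ioc, add_zero, two_mul]
  rw [hI, Finset.sum_map, Finset.mul_sum]
  simp only [addLeftEmbedding_apply, ite_mul, zero_mul]
  rw [← Finset.sum_filter]
  have hfilter : (Icc 1 x).filter (fun r : ℕ => ∀ p ∈ (x + r).primeFactors, z ≤ (p : ℝ)) =
      (Icc 1 x).filter (fun r : ℕ => ∀ p ∈ Nat.primesBelow ⌈z⌉₊,
          r % p ∉ ({(p - x % p) % p} : Finset ℕ)) :=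
    Finset.filter_congr fun r hr => rough_add_iff x z (Finset.mem_Icc.1 hr).1
  rw [hfilter]
  refine Finset.sum_congr rfl fun r hr => ?_
  have h2 : 2 ∈ Nat.primesBelow ⌈z⌉₊ :=
    Nat.mem_primesBelow.2 ⟨Nat.lt_ceil.2 (by exact_mod_cast hz), Nat.prime_two⟩
  have hodd : ¬ 2 ∣ x + r := by
    have h := (Finset.mem_filter.1 hr).2 2 h2
    rwa [Finset.mem_singleton, ← dvd_add_iff_mod_eq two_pos] at h
  rw [if_neg hodd]

/-! ### The remainder classes -/

/-- For squarefree `d`, the admissible classes `c mod d` of the signed interval sieve (those with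
`c % q ≡ −x (mod q)` for every prime `q ∣ d`) reduce to the single class `c ≡ −x (mod d)`. -/
theorem filter_admissible_subset {d : ℕ} (hd : Squarefree d) (x : ℕ) :
    (Finset.range d).filter (fun c : ℕ => ∀ q ∈ d.primeFactors,
        c % q ∈ (({(q - x % q) % q} : Finset ℕ))) ⊆ {(d - x % d) % d} := by
  intro c hc
  rw [Finset.mem_filter, Finset.mem_range] at hc
  rw [Finset.mem_singleton]
  have hd0 : 0 < d := Nat.pos_of_ne_zero hd.ne_zero
  have hdvd : d ∣ x + c := by
    rw [← Nat.prod_primeFactors_of_squarefree hd]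
    refine Finset.prod_primes_dvd _ (fun q hq => Nat.prime_iff.1 (Nat.prime_of_mem_primeFactors hq))
      fun q hq => ?_
    have h := hc.2 q hq
    rw [Finset.mem_singleton] at h
    exact (dvd_add_iff_mod_eq (Nat.prime_of_mem_primeFactors hq).pos x c).2 h
  have h := (dvd_add_iff_mod_eq hd0 x c).1 hdvd
  rwa [Nat.mod_eq_of_lt hc.1] at h

/-- The inner remainder sum of the signed sieve at a squarefree modulus `d` is at most
`|Σ_{1 ≤ r ≤ x, d ∣ x + r} σ(r)|`. -/
theorem sum_admissible_le {d : ℕ} (hd : Squarefree d) (x : ℕ) (σ : ℕ → ℝ) :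
    ∑ c ∈ (Finset.range d).filter (fun c : ℕ => ∀ q ∈ d.primeFactors,
        c % q ∈ (({(q - x % q) % q} : Finset ℕ))),
      |∑ r ∈ (Finset.Icc 1 x).filter (fun r : ℕ => r % d = c), σ r| ≤
      |∑ r ∈ (Finset.Icc 1 x).filter (fun r : ℕ => d ∣ x + r), σ r| := by
  have hd0 : 0 < d := Nat.pos_of_ne_zero hd.ne_zero
  refine (Finset.sum_le_sum_of_subset_of_nonneg (filter_admissible_subset hd x)
    (fun _ _ _ => abs_nonneg _)).trans ?_
  rw [Finset.sum_singleton]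
  have hf : (Finset.Icc 1 x).filter (fun r : ℕ => r % d = (d - x % d) % d) =
      (Finset.Icc 1 x).filter (fun r : ℕ => d ∣ x + r) :=
    Finset.filter_congr fun r _ => (dvd_add_iff_mod_eq hd0 x r).symm
  rw [hf]

/-- For odd `d` and `m = x + r + 2`: (`d ∣ x + r` and `x + r` odd) iff `m ≡ d + 2 (mod 2d)`. -/
theorem dvd_and_odd_iff {d : ℕ} (hd : Odd d) (x r : ℕ) :
    (d ∣ x + r ∧ ¬ 2 ∣ x + r) ↔ ((x + 2 + r : ℕ) : ZMod (2 * d)) = ((d + 2 : ℕ) : ZMod (2 * d)) := by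
  rw [ZMod.natCast_eq_natCast_iff, ← Nat.modEq_and_modEq_iff_modEq_mul (Nat.coprime_two_left.2 hd)]
  have hd1 := Nat.odd_iff.1 hd
  constructor
  · rintro ⟨hdvd, hodd⟩
    refine ⟨?_, ?_⟩
    · change (x + 2 + r) % 2 = (d + 2) % 2
      omega
    · have h1 : x + r ≡ 0 [MOD d] := Nat.modEq_zero_iff_dvd.2 hdvd
      have h2 := Nat.ModEq.add_right 2 h1
      rw [zero_add] at h2
      have h3 : d + 2 ≡ 2 [MOD d] := by
        change (d + 2) % d = 2 % d; rw [Nat.add_mod_left]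
      rw [show x + 2 + r = x + r + 2 by ring]
      exact h2.trans h3.symm
  · rintro ⟨h2, hd'⟩
    refine ⟨?_, ?_⟩
    · have h3 : d + 2 ≡ 2 [MOD d] := by
        change (d + 2) % d = 2 % d; rw [Nat.add_mod_left]
      have h4 : x + r + 2 ≡ 0 + 2 [MOD d] := by
        rw [zero_add, show x + r + 2 = x + 2 + r by ring]; exact hd'.trans h3
      exact Nat.modEq_zero_iff_dvd.1 (Nat.ModEq.add_right_cancel' 2 h4)
    · change (x + 2 + r) % 2 = (d + 2) % 2 at h2
      omega

/-- For odd `d`, the class sum at modulus `d` against `σ(r) = λ(x+r+2)·1[2 ∤ x+r]` is bounded by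
two Liouville sums in the reduced class `d + 2 (mod 2d)`, at heights `2x+2` and `x+2`. -/
theorem abs_classSum_le_of_odd {d : ℕ} (hodd : Odd d) (x : ℕ) :
    |∑ r ∈ (Finset.Icc 1 x).filter (fun r : ℕ => d ∣ x + r),
        (if 2 ∣ x + r then 0 else (ArithmeticFunction.liouville (x + r + 2) : ℝ))| ≤
      |∑ m ∈ (Finset.Icc 1 (2 * x + 2)).filter
          (fun m : ℕ => (m : ZMod (2 * d)) = ((d + 2 : ℕ) : ZMod (2 * d))),
          (ArithmeticFunction.liouville m : ℝ)| +
      |∑ m ∈ (Finset.Icc 1 (x + 2)).filter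
          (fun m : ℕ => (m : ZMod (2 * d)) = ((d + 2 : ℕ) : ZMod (2 * d))),
          (ArithmeticFunction.liouville m : ℝ)| := by
  set g : ℕ → ℝ := fun m => if ((m : ℕ) : ZMod (2 * d)) = ((d + 2 : ℕ) : ZMod (2 * d)) then
    (ArithmeticFunction.liouville m : ℝ) else 0 with hg
  have hLHS : ∑ r ∈ (Finset.Icc 1 x).filter (fun r : ℕ => d ∣ x + r),
      (if 2 ∣ x + r then 0 else (ArithmeticFunction.liouville (x + r + 2) : ℝ)) =
      ∑ r ∈ Finset.Icc 1 x, g (x + 2 + r) := by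
    rw [Finset.sum_filter]
    refine Finset.sum_congr rfl fun r _ => ?_
    have key := dvd_and_odd_iff hodd x r
    simp only [hg]
    by_cases hc : ((x + 2 + r : ℕ) : ZMod (2 * d)) = ((d + 2 : ℕ) : ZMod (2 * d))
    · obtain ⟨h1, h2⟩ := key.2 hc
      rw [if_pos h1, if_neg h2, if_pos hc, Nat.add_right_comm x 2 r]
    · rw [if_neg hc]
      by_cases h1 : d ∣ x + r
      · rw [if_pos h1]
        by_cases h2 : 2 ∣ x + r
        · rw [if_pos h2]
        · exact absurd (key.1 ⟨h1, h2⟩) hc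
      · rw [if_neg h1]
  have hshift : ∑ r ∈ Finset.Icc 1 x, g (x + 2 + r) = ∑ m ∈ Ioc (x + 2) (2 * x + 2), g m := by
    rw [← zero_add 1, Finset.Icc_add_one_left_eq_Ioc,
      show Ioc (x + 2) (2 * x + 2) = (Ioc 0 x).map (addLeftEmbedding (x + 2)) by
        rw [Finset.map_add_left_Ioc, add_zero, show x + 2 + x = 2 * x + 2 by ring],
      Finset.sum_map]
    simp only [addLeftEmbedding_apply]
  have hsplit : ∑ m ∈ Ioc (x + 2) (2 * x + 2), g m =
      ∑ m ∈ Ioc 0 (2 * x + 2), g m - ∑ m ∈ Ioc 0 (x + 2), g m := by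
    rw [← Finset.sum_Ioc_consecutive g (Nat.zero_le (x + 2)) (by omega : x + 2 ≤ 2 * x + 2)]
    ring
  have hS : ∀ N : ℕ, ∑ m ∈ Ioc 0 N, g m =
      ∑ m ∈ (Finset.Icc 1 N).filter
        (fun m : ℕ => (m : ZMod (2 * d)) = ((d + 2 : ℕ) : ZMod (2 * d))),
        (ArithmeticFunction.liouville m : ℝ) := by
    intro N
    rw [← zero_add 1, Finset.Icc_add_one_left_eq_Ioc, Finset.sum_filter]
  rw [hLHS, hshift, hsplit, hS, hS]
  exact abs_sub _ _

end Summit.Parity.GeneralizedHardyLittlewood.Theorems.ParityLeakOneFifth
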